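import Mathlib
import Summits.MatrixMultiplication.MatrixMultiplication.Theorems.SubgroupIdentityDesigns.Negative.TwoRankCriterion

/-!
# The global left kernel of the line-row matrix on `GL₂(𝔽_p)` and the rank (FR) FAIL criterion WITHOUT a dimension
count (negative-side lemma for the crux `SubgroupIdentityDesigns`, stmt-MatrixMultiplication-14079; cell B2b-5,
gen 8 — report `run/shared/lean/b2b/levelgraded-cu/ORACLE-g8.md`; certificate formats ORACLE-g7 §G7-1)

The FR certificates of the `(2,1,11)` census claim FAIL from `|H₁H₃| + rank_{GF(2)}(M_{S ∖ H₁H₃}) > D₁(11) = 1418`,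
where `D₁(p) = 1 + p² + (p-2)(p+1)²` was quoted as the dimension of the level-one functions on `GL₂(𝔽_p)` — a
representation-theoretic PAPER count (gen 7 left it unformalised).  This file removes it: for line representatives
`u_l` (`l ∈ L`; non-zero, pairwise non-proportional, covering the non-zero vectors — so `|L| = p+1`) the line-row
matrix (rows `ι = L × {w ≠ 0}`, entry `[s u_l = w]`) has `2(|L|-1)` explicit ℤ-independent INTEGER left-kernel vectors
valid at EVERY invertible `s`:
`R_l - R_{l₀}` (`l ≠ l₀`) and `C_{l'} - R_{l₀}` (`l' ≠ l₀`), with `R_l = Σ_w row_{(l,w)}` (`= 1`: the image of a line is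
one non-zero vector) and `C_{l'} = Σ_m Σ_{w ∈ 𝔽_p u_{l'}} row_{(m,w)}` (`= 1`: exactly one line is mapped onto the line
of `u_{l'}`).  Hence `rank M_S ≤ |ι| - 2(|L|-1) = (p+1)(p²-1) - 2p = D₁(p)` on every `S ⊆ GL₂(𝔽_p)` (for `p = 11`:
`1440 - 22 = 1418`), and by the two-rank criterion (`TwoRankCriterion.no_levelOne_design_of_twoRank`, fed with these
global relations) an FR certificate refutes the identity-design clause at `(m,k) = (2,1)`:

* `sum_line_indicator`, `sum_coline_indicator` — the two row sums equal `1` at every invertible `s`;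
* `linearIndependent_rel` — ℤ-independence of the `2(|L|-1)` relations;
* `exists_global_relations` — packaged as `Fin (2(|L|-1))`-indexed integer left-kernel vectors;
* `no_levelOne_design_of_rank` — `|ι| < |T| + rank_F(M_{S∖T}) + 2(|L|-1)` (any field `F`, `T ⊆ H₁H₃`) ⇒ no design.

So every FR line of the census is an instance of a Lean theorem whose hypotheses the engine-free verifier
(`verify_rank.py`: recompute `S`, `T = H₁H₃`, the `GF(2)` rank) checks; no paper step remains in either certificate
format (GHOST: `FibreGhost`; FL: `TwoRankCriterion`; FR: this file).
Sorry-free; axioms `propext, Classical.choice, Quot.sound`.  VALUE = soundness theorem for a certificate format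
(decidable-verdict infrastructure), NOT summit progress.
-/

set_option linter.dupNamespace false

noncomputable section

open scoped BigOperators Classical
open Matrix
open Summit.MatrixMultiplication.MatrixMultiplication.Theorems.LieRankDesigns.Negative (GLm Mat)

namespace Summit.MatrixMultiplication.MatrixMultiplication.Theorems.SubgroupIdentityDesigns.Negative

namespace GlobalRelations

variable {p : ℕ} [Fact p.Prime] {L : Type*} [Fintype L]

/-- Row sum over one INPUT line: `Σ_{(m,w)} [m = l]·[s u_m = w] = 1` for invertible `s` and `u_l ≠ 0`
(the image `s u_l` is a single non-zero vector). -/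
theorem sum_line_indicator (u : L → (Fin 2 → ZMod p)) (s : CMat p 2) (hs : IsUnit s.det) (l : L)
    (hl : u l ≠ 0) :
    ∑ i : L × {w : Fin 2 → ZMod p // w ≠ 0},
      (if i.1 = l then (1 : ℤ) else 0) * (if s.mulVec (u i.1) = i.2.1 then (1 : ℤ) else 0) = 1 := by
  have hv : s.mulVec (u l) ≠ 0 := LineRows.mulVec_ne_zero_of_isUnit_det s hs (u l) hl
  rw [Fintype.sum_prod_type, Fintype.sum_eq_single l]
  · simp only [if_true, one_mul]
    rw [Fintype.sum_eq_single (⟨s.mulVec (u l), hv⟩ : {w : Fin 2 → ZMod p // w ≠ 0})]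
    · simp
    · intro w hw
      rw [if_neg]
      exact fun h => hw (Subtype.ext h.symm)
  · intro m hm
    simp [hm]

/-- Row sum over one OUTPUT line: `Σ_{(m,w)} [w ∈ 𝔽_p u_{l'}]·[s u_m = w] = 1` for invertible `s`, when the `u_l` are
non-zero, pairwise non-proportional and cover the non-zero vectors (exactly one input line is mapped onto the line
of `u_{l'}`). -/
theorem sum_coline_indicator (u : L → (Fin 2 → ZMod p))
    (hu : ∀ a : Fin 2 → ZMod p, a ≠ 0 → ∃ l, ∃ c : ZMod p, c ≠ 0 ∧ a = c • u l)
    (hu0 : ∀ l, u l ≠ 0) (huinj : ∀ l l' : L, ∀ c : ZMod p, u l = c • u l' → l = l')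
    (s : CMat p 2) (hs : IsUnit s.det) (l' : L) :
    ∑ i : L × {w : Fin 2 → ZMod p // w ≠ 0},
      (if (∃ c : ZMod p, i.2.1 = c • u l') then (1 : ℤ) else 0) *
        (if s.mulVec (u i.1) = i.2.1 then (1 : ℤ) else 0) = 1 := by
  -- the unique input line mapped onto the line of `u l'`
  set v : Fin 2 → ZMod p := s⁻¹.mulVec (u l') with hv
  have hv0 : v ≠ 0 :=
    LineRows.mulVec_ne_zero_of_isUnit_det _ (Matrix.isUnit_nonsing_inv_det s hs) _ (hu0 l')
  obtain ⟨m₀, c₀, hc₀, hm₀⟩ := hu v hv0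
  have hsv : s.mulVec v = u l' := by
    rw [hv, Matrix.mulVec_mulVec, Matrix.mul_nonsing_inv _ hs, Matrix.one_mulVec]
  have hP0 : ∃ c : ZMod p, s.mulVec (u m₀) = c • u l' := by
    refine ⟨c₀⁻¹, ?_⟩
    have : u m₀ = c₀⁻¹ • v := by rw [hm₀, smul_smul, inv_mul_cancel₀ hc₀, one_smul]
    rw [this, Matrix.mulVec_smul, hsv]
  have hPuniq : ∀ m, (∃ c : ZMod p, s.mulVec (u m) = c • u l') → m = m₀ := by
    rintro m ⟨c, hc⟩
    apply huinj m m₀ (c * c₀)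
    have h1 : u m = s⁻¹.mulVec (s.mulVec (u m)) := by
      rw [Matrix.mulVec_mulVec, Matrix.nonsing_inv_mul _ hs, Matrix.one_mulVec]
    rw [h1, hc, Matrix.mulVec_smul, ← hv, hm₀, smul_smul]
  -- collapse the inner sums: only `w = s u_m` contributes
  have hinner : ∀ m : L, ∑ w : {w : Fin 2 → ZMod p // w ≠ 0},
      (if (∃ c : ZMod p, w.1 = c • u l') then (1 : ℤ) else 0) *
        (if s.mulVec (u m) = w.1 then (1 : ℤ) else 0) =
      if (∃ c : ZMod p, s.mulVec (u m) = c • u l') then 1 else 0 := by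
    intro m
    have hw : s.mulVec (u m) ≠ 0 := LineRows.mulVec_ne_zero_of_isUnit_det s hs (u m) (hu0 m)
    rw [Fintype.sum_eq_single (⟨s.mulVec (u m), hw⟩ : {w : Fin 2 → ZMod p // w ≠ 0})]
    · simp
    · intro w hw'
      have : ¬ s.mulVec (u m) = w.1 := fun h => hw' (Subtype.ext h.symm)
      rw [if_neg this, mul_zero]
  rw [Fintype.sum_prod_type]
  simp only [hinner]
  rw [Fintype.sum_eq_single m₀]
  · rw [if_pos hP0]
  · intro m hm
    rw [if_neg (fun h => hm (hPuniq m h))]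

/-- The `2(|L| - 1)` GLOBAL RELATIONS among the line rows are ℤ-linearly independent:
`R_l - R_{l₀}` (`l ≠ l₀`) and `C_{l'} - R_{l₀}` (`l' ≠ l₀`), where `R_l = Σ_{w} row_{(l,w)}` and
`C_{l'} = Σ_{m} Σ_{w ∈ 𝔽_p u_{l'}} row_{(m,w)}`. -/
theorem linearIndependent_rel (u : L → (Fin 2 → ZMod p)) (hu0 : ∀ l, u l ≠ 0)
    (huinj : ∀ l l' : L, ∀ c : ZMod p, u l = c • u l' → l = l') (l₀ : L) :
    LinearIndependent ℤ (Sum.elim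
      (fun (l : {l : L // l ≠ l₀}) (i : L × {w : Fin 2 → ZMod p // w ≠ 0}) =>
        (if i.1 = l.1 then (1 : ℤ) else 0) - (if i.1 = l₀ then (1 : ℤ) else 0))
      (fun (l : {l : L // l ≠ l₀}) (i : L × {w : Fin 2 → ZMod p // w ≠ 0}) =>
        (if (∃ c : ZMod p, i.2.1 = c • u l.1) then (1 : ℤ) else 0) - (if i.1 = l₀ then (1 : ℤ) else 0))) := by
  rw [Fintype.linearIndependent_iff]
  intro g hg
  have hval : ∀ i : L × {w : Fin 2 → ZMod p // w ≠ 0},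
      (∑ l : {l : L // l ≠ l₀}, g (Sum.inl l) *
          ((if i.1 = l.1 then (1 : ℤ) else 0) - (if i.1 = l₀ then (1 : ℤ) else 0))) +
        ∑ l : {l : L // l ≠ l₀}, g (Sum.inr l) *
          ((if (∃ c : ZMod p, i.2.1 = c • u l.1) then (1 : ℤ) else 0) - (if i.1 = l₀ then (1 : ℤ) else 0)) = 0 := by
    intro i
    have h := congrFun hg i
    simpa [Finset.sum_apply, Fintype.sum_sum_type] using h
  -- no `u l` with `l ≠ l₀` is proportional to `u l₀`
  have hline0 : ∀ l : {l : L // l ≠ l₀}, ¬ ∃ c : ZMod p, u l₀ = c • u l.1 :=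
    fun l ⟨c, hc⟩ => l.2 (huinj l₀ l.1 c hc).symm
  have hlineself : ∀ l l₁ : {l : L // l ≠ l₀}, (∃ c : ZMod p, u l₁.1 = c • u l.1) ↔ l = l₁ := by
    intro l l₁
    constructor
    · rintro ⟨c, hc⟩; exact Subtype.ext (huinj l₁.1 l.1 c hc).symm
    · rintro rfl; exact ⟨1, (one_smul _ _).symm⟩
  -- Step A: the coefficients of the `R`-relations vanish (evaluate at `(l₁, u l₀)`)
  have hA : ∀ l₁ : {l : L // l ≠ l₀}, g (Sum.inl l₁) = 0 := by
    intro l₁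
    have h := hval (l₁.1, ⟨u l₀, hu0 l₀⟩)
    simp only [l₁.2, if_false, sub_zero, hline0, mul_zero, Finset.sum_const_zero, add_zero] at h
    rw [Fintype.sum_eq_single l₁] at h
    · simpa using h
    · intro l hl
      rw [if_neg (fun h' => hl (Subtype.ext h'.symm)), mul_zero]
  -- Step B: the coefficients of the `C`-relations vanish (evaluate at `(l₁, u l₁)`)
  have hB : ∀ l₁ : {l : L // l ≠ l₀}, g (Sum.inr l₁) = 0 := by
    intro l₁
    have h := hval (l₁.1, ⟨u l₁.1, hu0 l₁.1⟩)
    simp only [l₁.2, if_false, sub_zero, hA, zero_mul, Finset.sum_const_zero, zero_add] at h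
    simp only [hlineself] at h
    rw [Fintype.sum_eq_single l₁] at h
    · simpa using h
    · intro l hl
      rw [if_neg hl, mul_zero]
  intro j
  cases j with
  | inl l => exact hA l
  | inr l => exact hB l

/-- **THE GLOBAL LEFT KERNEL.**  For line representatives `u_l` (non-zero, pairwise non-proportional, covering the
non-zero vectors) there are `2(|L| - 1)` ℤ-independent INTEGER left-kernel vectors of the line-row matrix valid at
EVERY invertible matrix `s` — hence on every column set `S ⊆ GL₂(𝔽_p)`.  (`|L| = p + 1`, so this is the rank bound
`rank M_S ≤ (p+1)(p²-1) - 2p = 1 + p² + (p-2)(p+1)² = D₁(p)` used by the FR certificates; `1418` for `p = 11`.) -/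
theorem exists_global_relations (u : L → (Fin 2 → ZMod p))
    (hu : ∀ a : Fin 2 → ZMod p, a ≠ 0 → ∃ l, ∃ c : ZMod p, c ≠ 0 ∧ a = c • u l)
    (hu0 : ∀ l, u l ≠ 0) (huinj : ∀ l l' : L, ∀ c : ZMod p, u l = c • u l' → l = l') (l₀ : L) :
    ∃ α : Fin (2 * (Fintype.card L - 1)) → (L × {w : Fin 2 → ZMod p // w ≠ 0} → ℤ),
      LinearIndependent ℤ α ∧
      ∀ j, ∀ s : CMat p 2, IsUnit s.det →
        ∑ i : L × {w : Fin 2 → ZMod p // w ≠ 0},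
          α j i * (if s.mulVec (u i.1) = i.2.1 then (1 : ℤ) else 0) = 0 := by
  have hcard : Fintype.card ({l : L // l ≠ l₀} ⊕ {l : L // l ≠ l₀}) = 2 * (Fintype.card L - 1) := by
    rw [Fintype.card_sum, Fintype.card_subtype_compl, Fintype.card_subtype_eq]
    omega
  let e : Fin (2 * (Fintype.card L - 1)) ≃ ({l : L // l ≠ l₀} ⊕ {l : L // l ≠ l₀}) :=
    (Fintype.equivFinOfCardEq hcard).symm
  refine ⟨(Sum.elim
      (fun (l : {l : L // l ≠ l₀}) (i : L × {w : Fin 2 → ZMod p // w ≠ 0}) =>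
        (if i.1 = l.1 then (1 : ℤ) else 0) - (if i.1 = l₀ then (1 : ℤ) else 0))
      (fun (l : {l : L // l ≠ l₀}) (i : L × {w : Fin 2 → ZMod p // w ≠ 0}) =>
        (if (∃ c : ZMod p, i.2.1 = c • u l.1) then (1 : ℤ) else 0) - (if i.1 = l₀ then (1 : ℤ) else 0))) ∘ e,
    (linearIndependent_rel u hu0 huinj l₀).comp e e.injective, ?_⟩
  intro j s hs
  rw [Function.comp_apply]
  cases he : e j with
  | inl l =>
    simp only [Sum.elim_inl, sub_mul, Finset.sum_sub_distrib]
    rw [sum_line_indicator u s hs l.1 (hu0 _), sum_line_indicator u s hs l₀ (hu0 _), sub_self]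
  | inr l =>
    simp only [Sum.elim_inr, sub_mul, Finset.sum_sub_distrib]
    rw [sum_coline_indicator u hu hu0 huinj s hs l.1, sum_line_indicator u s hs l₀ (hu0 _), sub_self]

/-- **NO LEVEL-ONE IDENTITY DESIGN UNDER A RANK (FR) CERTIFICATE — without the dimension count.**  With line
representatives `u_l` as above (`|L| = p+1` lines, rows `ι = L × {w ≠ 0}`), subgroups `H₁, H₂, H₃ ≤ GL₂(𝔽_p)`,
`T ⊆ S = H₁H₂H₃` inside `H₁H₃`, and ANY field `F` (the verifier uses `GF(2)`):
`|ι| - 2(|L|-1) < |T| + rank_F(M_S restricted to S ∖ T)` refutes the identity-design clause at `(m,k) = (2,1)`.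
For `p = 11`: `1418 < |T| + rank_{GF(2)}(M_rest)` — exactly the FR inequality of ORACLE-g7 §G7-1, whose bound
`D₁(11) = 1418` was a paper dimension count; here it is the two-rank criterion fed with the global left kernel. -/
theorem no_levelOne_design_of_rank (u : L → (Fin 2 → ZMod p))
    (hu : ∀ a : Fin 2 → ZMod p, a ≠ 0 → ∃ l, ∃ c : ZMod p, c ≠ 0 ∧ a = c • u l)
    (hu0 : ∀ l, u l ≠ 0) (huinj : ∀ l l' : L, ∀ c : ZMod p, u l = c • u l' → l = l')
    (H₁ H₂ H₃ : Subgroup (GLm p 2))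
    (T : Finset {s : CMat p 2 // ∃ a ∈ H₁, ∃ b ∈ H₂, ∃ g ∈ H₃, s = ((a * b * g : GLm p 2) : Mat p 2)})
    (hT : ∀ x ∈ T, ∃ a₀ ∈ H₁, ∃ g₀ ∈ H₃, (x : CMat p 2) = ((a₀ * g₀ : GLm p 2) : Mat p 2))
    (F : Type*) [Field F]
    (hlt : Fintype.card (L × {w : Fin 2 → ZMod p // w ≠ 0}) <
      T.card + Module.finrank F (Submodule.span F (Set.range fun i : L × {w : Fin 2 → ZMod p // w ≠ 0} =>
        fun s : {s : {s : CMat p 2 // ∃ a ∈ H₁, ∃ b ∈ H₂, ∃ g ∈ H₃, s = ((a * b * g : GLm p 2) : Mat p 2)} //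
          s ∉ T} => if ((s : _) : CMat p 2).mulVec (u i.1) = i.2.1 then (1 : F) else 0)) +
        2 * (Fintype.card L - 1)) :
    ¬ ∃ c : Matrix (Fin 2) (Fin 2) (ZMod p) → ℂ, (∀ M, 1 < M.rank → c M = 0) ∧
      (∑ M, c M * ZMod.stdAddChar (Matrix.trace (M * ((1 : GLm p 2) : Mat p 2)))) = 1 ∧
      ∀ a ∈ H₁, ∀ b ∈ H₂, ∀ g ∈ H₃, a * b * g ≠ 1 →
        (∑ M, c M * ZMod.stdAddChar
          (Matrix.trace (M * ((a * b * g : GLm p 2) : Mat p 2)))) = 0 := by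
  classical
  obtain ⟨l₀⟩ : Nonempty L := by
    have he : (![1, 0] : Fin 2 → ZMod p) ≠ 0 := by
      intro h; have := congrFun h 0; simp at this
    obtain ⟨l, -, -, -⟩ := hu _ he
    exact ⟨l⟩
  obtain ⟨α, hα, hrel⟩ := exists_global_relations u hu hu0 huinj l₀
  refine TwoRankCriterion.no_levelOne_design_of_twoRank u hu H₁ H₂ H₃ T hT α hα ?_ F hlt
  intro j s
  obtain ⟨a, -, b, -, g, -, hs⟩ := s.2
  have hunit : IsUnit (s : CMat p 2).det := by
    rw [hs]; exact Matrix.isUnits_det_units _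
  exact hrel j (s : CMat p 2) hunit

end GlobalRelations

end Summit.MatrixMultiplication.MatrixMultiplication.Theorems.SubgroupIdentityDesigns.Negative
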